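import Literature.AlgebraicGeometry.HodgeTheory.HodgeConjectureProductsOddHypersurfacesSupportedMiddle
import Literature.AlgebraicGeometry.ShiodaKatsura1979.SplitFormsNonsingular
import Literature.AlgebraicGeometry.HodgeTheory.HodgeConjectureProductsCubicFivefoldsOfELV
import HarnessLib

/-!
# The Hodge conjecture for products of two smooth hypersurface threefolds of degree `≤ 4` cut out by
# NONSINGULAR FORMS, and for pairs of Fermat suspensions `V(f + u⁴) × V(g + v⁴)` of nonsingular quartics —
# LEMMA AB (4;3,3) of the split-hypersurface programme, in the binder shape of its sketch

Family `hodge`, layer `Literature/AlgebraicGeometry/ShiodaKatsura1979`; written for the cell `hodge-nonav`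
(planner memo ROUTE-P3v20 «SPLIT HYPERSURFACES» after Shioda–Katsura 1979, sketch `SplitSketch.lean` r5).
THEOREMS ONLY (no definition, no named fact, no instance; D-0026 net debt `0`).

The kernel form of record of THEOREM T8 of that memo,
`splitQuarticSixfoldHCN_of_facts (hSK) (hK3) (hK3P : HC_K3Pairs) (hAB : QuarticSuspensionPairsHCN)`
(«HC for EVERY smooth split quartic sixfold `{f(x₀..x₃) + g(y₀..y₃) = 0} ⊂ ℙ⁷`»), had one proving target left,
LEMMA AB at `(m; r, s) = (4; 3, 3)`:

  `QuarticSuspensionPairsHCN := ∀ f g : MvPolynomial (Fin (3+1)) ℂ, f.IsHomogeneous 4 → g.IsHomogeneous 4 →`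
  `  IsNonsingularForm ℂ f → IsNonsingularForm ℂ g → ∀ F_f F_g, IsSmoothProjective 3 F_f →`
  `  IsHypersurfaceCutOutBy (3+1) (suspension 4 3 f) F_f → IsSmoothProjective 3 F_g →`
  `  IsHypersurfaceCutOutBy (3+1) (suspension 4 3 g) F_g → HodgeConjectureFor (3+3) (F_f ⊗ F_g)`.

It is PROVED here VERBATIM (`hodgeConjectureFor_tensor_quarticSuspensions`), unconditionally, from the tree's
theorem `Motives.IsSmoothHypersurface.hodgeConjectureFor_tensor_threefolds_of_degree_le_four`
(`HodgeTheory/HodgeConjectureProductsOddHypersurfacesSupportedMiddle`: `HC(Y × Y')` for any two smooth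
hypersurface threefolds of degrees `≤ 4` in `ℙ⁴_ℂ` — Roitman's lines/strong lines put `CH₀` on a hyperplane
section, Bloch–Srinivas gives `H³ = N¹H³`, the Künneth piece `H³ ⊗ H³` is then supported in codimension `2` and
its Hodge classes are algebraic by Voisin 2013 Lemma 2.1 = Deligne 8.2.8 + semisimplicity + Lefschetz `(1,1)`),
through the bridge «a smooth projective `n`-fold cut out set-theoretically by a NONSINGULAR form of degree `d` is
a smooth hypersurface of degree `d`» (`isSmoothHypersurface_of_isHypersurfaceCutOutBy_of_isNonsingularForm`: the
form is irreducible, `SmoothHypersurface.IsNonsingularForm.irreducible`, Hartshorne II 8.20.2) and Shioda–Katsura's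
Remark 1.10 «`f` nonsingular ⇒ `f + u^m` nonsingular» (the tree's `isNonsingularForm_suspension`).

WHAT IS PROVED.
* `isSmoothHypersurface_of_isHypersurfaceCutOutBy_of_isNonsingularForm`, `…_suspension` (bridges).
* `hodgeConjectureFor_tensor_of_isHypersurfaceCutOutBy_threefolds_of_degree_le_four` — `HC(F × F')` for smooth
  projective threefolds cut out in `ℙ⁴_ℂ` by nonsingular quinary forms of degrees `1 ≤ d, d' ≤ 4`.
* **`hodgeConjectureFor_tensor_quarticSuspensions`** — LEMMA AB (4;3,3) in the sketch's binder shape; and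
  `hodgeConjectureFor_tensor_suspensions_of_degree_le_four` (suspensions `f + u^m`, `g + v^{m'}` of nonsingular
  quaternary forms of degrees `m, m' ≤ 4`).
* (appended) **`hodgeConjectureFor_tensor_cubicSuspensions_of_ELV`** — LEMMA AB (3;5,5) in the sketch's binder shape
  `CubicSuspensionPairsHCN`, GRANTED the tree's named fact `Motives.EsnaultLevineViehweg1997_chowGroup_rank_le_one`
  (cubic fivefolds: `CH₀ = CH₁ = ℚ` ⟹ `N²H⁵ = H⁵`; file `HodgeTheory/HodgeConjectureProductsCubicFivefoldsOfELV`).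

## References
* [ShiodaKatsura1979] T. Shioda, T. Katsura, *On Fermat varieties*, Tôhoku Math. J. 31 (1979) 97–115 — §1
  Remark 1.10 (nonsingularity of `f(x) + g(y)`), Thm. 1.7.
* [BlochSrinivas1983] S. Bloch, V. Srinivas, Amer. J. Math. 105 (1983) — Thm. 1.
* [Voisin2013GHCBloch] C. Voisin, Ann. Sci. ÉNS 46 (2013) — Lemma 2.1 (proof).
* [VoisinHodgeI2002] C. Voisin, *Hodge Theory and Complex Algebraic Geometry I* — §11.3.3 Thm. 11.38, Lemma 11.41.
* [Hartshorne1977] R. Hartshorne, *Algebraic Geometry* — II Example 8.20.2, I Ex. 5.8.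

## Provenance
Cell `hodge-nonav` (summit `HodgeConjecture`, rung F-H1), seat `littype-FH1-2` (literature-prover, generation 17).
-/

noncomputable section

open CategoryTheory MonoidalCategory MvPolynomial
open Literature.AlgebraicGeometry.Motives Literature.AlgebraicGeometry.Motives.SmoothHypersurface
open Literature.AlgebraicGeometry.HodgeTheory

namespace Literature.AlgebraicGeometry.ShiodaKatsura1979

variable {n d d' m m' : ℕ}

/-- **A smooth projective `n`-fold (`n ≥ 1`) cut out set-theoretically in `ℙ^{n+1}_ℂ` by a NONSINGULAR form of
degree `d ≥ 1` is a smooth hypersurface of dimension `n` and degree `d`** in the sense of the tree's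
`IsSmoothHypersurface` (which asks for an IRREDUCIBLE defining form): a nonsingular form in `≥ 3` variables is
irreducible. (For a possibly singular form the set-theoretic predicate `IsHypersurfaceCutOutBy` does not determine
the degree: `V₊(h²) = V₊(h)`.) [cite: Hartshorne1977, II Example 8.20.2 and I Ex. 5.8] -/
theorem isSmoothHypersurface_of_isHypersurfaceCutOutBy_of_isNonsingularForm (hn : 1 ≤ n) (hd : 1 ≤ d)
    {F : MvPolynomial (Fin (n + 2)) ℂ} (hF : F.IsHomogeneous d) (hJ : IsNonsingularForm ℂ F)
    {X : SchemeOver ℂ} (hX : IsSmoothProjective n X) (hcut : IsHypersurfaceCutOutBy (n + 1) F X) :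
    IsSmoothHypersurface n d X :=
  ⟨hX, F, hF, hJ.irreducible hn hd hF, hcut⟩

/-- **The Fermat suspension case**: a smooth projective `(n+1)`-fold cut out in `ℙ^{n+2}_ℂ` by the suspension
`f + u^m` of a nonsingular form `f` of degree `m ≥ 1` in `n + 2` variables is a smooth hypersurface of degree `m`
(Shioda–Katsura Remark 1.10: `f` nonsingular ⇒ `f + u^m` nonsingular, the tree's `isNonsingularForm_suspension`).
[cite: ShiodaKatsura1979, §1 Remark 1.10] [cite: Hartshorne1977, II Example 8.20.2] -/
theorem isSmoothHypersurface_of_isHypersurfaceCutOutBy_suspension (hm : 1 ≤ m)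
    {f : MvPolynomial (Fin (n + 2)) ℂ} (hf : f.IsHomogeneous m) (hJ : IsNonsingularForm ℂ f)
    {F : SchemeOver ℂ} (hF : IsSmoothProjective (n + 1) F)
    (hcut : IsHypersurfaceCutOutBy (n + 2) (suspension m (n + 1) f) F) : IsSmoothHypersurface (n + 1) m F :=
  isSmoothHypersurface_of_isHypersurfaceCutOutBy_of_isNonsingularForm (by omega) hm (isHomogeneous_suspension hf)
    (isNonsingularForm_suspension hm hJ) hF hcut

/-- **`HC(F × F')` for two smooth projective threefolds cut out in `ℙ⁴_ℂ` by NONSINGULAR quinary forms of degrees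
`1 ≤ d, d' ≤ 4`** (planes, quadrics, cubics, quartics in any combination) — unconditionally: the tree's
`Motives.IsSmoothHypersurface.hodgeConjectureFor_tensor_threefolds_of_degree_le_four` through the bridge above.
[cite: BlochSrinivas1983, Thm. 1] [cite: Voisin2013GHCBloch, Lemma 2.1 (proof)]
[cite: VoisinHodgeI2002, §11.3.3 Thm. 11.38, Lemma 11.41 and p. 287] -/
theorem hodgeConjectureFor_tensor_of_isHypersurfaceCutOutBy_threefolds_of_degree_le_four
    {F : MvPolynomial (Fin (3 + 2)) ℂ} {G : MvPolynomial (Fin (3 + 2)) ℂ} (hd : 1 ≤ d) (hd4 : d ≤ 4)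
    (hd' : 1 ≤ d') (hd'4 : d' ≤ 4) (hF : F.IsHomogeneous d) (hG : G.IsHomogeneous d')
    (hJF : IsNonsingularForm ℂ F) (hJG : IsNonsingularForm ℂ G) {X X' : SchemeOver ℂ}
    (hX : IsSmoothProjective 3 X) (hcutX : IsHypersurfaceCutOutBy (3 + 1) F X) (hX' : IsSmoothProjective 3 X')
    (hcutX' : IsHypersurfaceCutOutBy (3 + 1) G X') : HodgeConjectureFor (3 + 3) (X ⊗ X') :=
  (isSmoothHypersurface_of_isHypersurfaceCutOutBy_of_isNonsingularForm (by norm_num) hd hF hJF hX hcutX)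
    |>.hodgeConjectureFor_tensor_threefolds_of_degree_le_four
      (isSmoothHypersurface_of_isHypersurfaceCutOutBy_of_isNonsingularForm (by norm_num) hd' hG hJG hX' hcutX')
      hd hd4 hd' hd'4

/-- **`HC(F_f × F_g)` for the Fermat suspensions of two nonsingular QUATERNARY forms of degrees `1 ≤ m, m' ≤ 4`**:
`F_f`, `F_g` smooth projective threefolds cut out in `ℙ⁴_ℂ` by `f(x₀..x₃) + u^m`, `g(y₀..y₃) + v^{m'}`.
[cite: ShiodaKatsura1979, §1 Remark 1.10] [cite: BlochSrinivas1983, Thm. 1] [cite: Voisin2013GHCBloch, Lemma 2.1 (proof)] -/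
theorem hodgeConjectureFor_tensor_suspensions_of_degree_le_four (hm : 1 ≤ m) (hm4 : m ≤ 4) (hm' : 1 ≤ m')
    (hm'4 : m' ≤ 4) {f g : MvPolynomial (Fin (2 + 2)) ℂ} (hf : f.IsHomogeneous m) (hg : g.IsHomogeneous m')
    (hJf : IsNonsingularForm ℂ f) (hJg : IsNonsingularForm ℂ g) {F_f F_g : SchemeOver ℂ}
    (hFf : IsSmoothProjective 3 F_f) (hcutf : IsHypersurfaceCutOutBy (2 + 2) (suspension m 3 f) F_f)
    (hFg : IsSmoothProjective 3 F_g) (hcutg : IsHypersurfaceCutOutBy (2 + 2) (suspension m' 3 g) F_g) :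
    HodgeConjectureFor (3 + 3) (F_f ⊗ F_g) :=
  (isSmoothHypersurface_of_isHypersurfaceCutOutBy_suspension (n := 2) hm hf hJf hFf hcutf)
    |>.hodgeConjectureFor_tensor_threefolds_of_degree_le_four
      (isSmoothHypersurface_of_isHypersurfaceCutOutBy_suspension (n := 2) hm' hg hJg hFg hcutg) hm hm4 hm' hm'4

/-- **LEMMA AB (4;3,3) of the cell `hodge-nonav`, VERBATIM in the binder shape of the sketch's
`QuarticSuspensionPairsHCN`**: for NONSINGULAR quaternary quartics `f`, `g` and smooth projective threefolds
`F_f`, `F_g` cut out in `ℙ⁴_ℂ` by the suspensions `f + u⁴`, `g + v⁴`, the Hodge conjecture holds for `F_f × F_g` —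
unconditionally (quartic threefolds have `CH₀ = ℤ` up to torsion by Roitman's strong lines, so `H³` is supported on
a divisor by Bloch–Srinivas; then Künneth + Lefschetz `(1,1)` after lifting along Gysin maps). The sketch's
`quarticSuspensionPairsHCN_holds : QuarticSuspensionPairsHCN` is this theorem.
[cite: BlochSrinivas1983, Thm. 1] [cite: Voisin2013GHCBloch, Lemma 2.1 (proof)] [cite: ShiodaKatsura1979, §1 Remark 1.10]
[cite: VoisinHodgeI2002, §11.3.3 Thm. 11.38, Lemma 11.41 and p. 287] -/
theorem hodgeConjectureFor_tensor_quarticSuspensions :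
    ∀ (f g : MvPolynomial (Fin (3 + 1)) ℂ), f.IsHomogeneous 4 → g.IsHomogeneous 4 →
      IsNonsingularForm ℂ f → IsNonsingularForm ℂ g →
      ∀ (F_f F_g : SchemeOver ℂ),
        IsSmoothProjective 3 F_f → IsHypersurfaceCutOutBy (3 + 1) (suspension 4 3 f) F_f →
        IsSmoothProjective 3 F_g → IsHypersurfaceCutOutBy (3 + 1) (suspension 4 3 g) F_g →
        HodgeConjectureFor (3 + 3) (F_f ⊗ F_g) :=
  fun _ _ hf hg hJf hJg _ _ hFf hcutf hFg hcutg ↦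
    hodgeConjectureFor_tensor_suspensions_of_degree_le_four (by norm_num) le_rfl (by norm_num) le_rfl hf hg hJf hJg
      hFf hcutf hFg hcutg


/-! ### Appended (same seat): LEMMA AB (3;5,5) of the cell — cubic fivefold suspensions — granted Esnault–Levine–Viehweg -/

/-- **LEMMA AB (3;5,5) of the cell `hodge-nonav`, in the binder shape of the sketch's `CubicSuspensionPairsHCN`,
GRANTED the tree's named fact `Motives.EsnaultLevineViehweg1997_chowGroup_rank_le_one`**: for NONSINGULAR senary
cubics `f`, `g` and smooth projective fivefolds `F_f`, `F_g` cut out in `ℙ⁶_ℂ` by the suspensions `f + u³`, `g + v³`,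
the Hodge conjecture holds for `F_f × F_g` (ELV: `CH₀ = CH₁ = ℚ` for cubic fivefolds ⟹ `N²H⁵ = H⁵`; then Künneth +
Voisin 2013 Lemma 2.1 — the tree's `HodgeTheory.hodgeConjectureFor_tensor_cubicFivefolds_of_ELV`). With the sketch's
`splitCubicTenfoldHCN_of_SK'` this makes THEOREM T6 («`HC⁸(Y_f × Y_g) ⇒ HC({f(x)+g(y)=0})`» for cubic tenfolds) a
tree theorem modulo the two cited facts S–K 1979 §1 and ELV 1997 Thm. 4.6.
[cite: EsnaultLevineViehweg1997, Thm 4.6 (announced as Thm 4.5 in the Introduction), first bullet]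
[cite: ShiodaKatsura1979, §1 Remark 1.10] [cite: Voisin2013GHCBloch, Lemma 2.1 (proof)] -/
theorem hodgeConjectureFor_tensor_cubicSuspensions_of_ELV
    (hELV : Literature.AlgebraicGeometry.Motives.EsnaultLevineViehweg1997_chowGroup_rank_le_one.{0}) :
    ∀ (f g : MvPolynomial (Fin (5 + 1)) ℂ), f.IsHomogeneous 3 → g.IsHomogeneous 3 →
      IsNonsingularForm ℂ f → IsNonsingularForm ℂ g →
      ∀ (F_f F_g : SchemeOver ℂ),
        IsSmoothProjective 5 F_f → IsHypersurfaceCutOutBy (5 + 1) (suspension 3 5 f) F_f →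
        IsSmoothProjective 5 F_g → IsHypersurfaceCutOutBy (5 + 1) (suspension 3 5 g) F_g →
        HodgeConjectureFor (5 + 5) (F_f ⊗ F_g) :=
  fun _ _ hf hg hJf hJg _ _ hFf hcutf hFg hcutg ↦
    hodgeConjectureFor_tensor_cubicFivefolds_of_ELV hELV (isHomogeneous_suspension hf) (isHomogeneous_suspension hg)
      (isNonsingularForm_suspension (n := 4) (by norm_num) hJf) (isNonsingularForm_suspension (n := 4) (by norm_num) hJg)
      hFf hcutf hFg hcutg

end Literature.AlgebraicGeometry.ShiodaKatsura1979

end
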